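import Summits.BirchSwinnertonDyer.BirchSwinnertonDyer.Theses.ErratumRoadFive
import Summits.BirchSwinnertonDyer.BirchSwinnertonDyer.Theorems.ErratumRoadFiveOpenInputIMCNoSecondPrime
import HarnessLib

/-!
# Route `ErratumRoadFive`, child crux `OpenInputRamOffErratumLocus` (item stmt-BirchSwinnertonDyer-19274)
# of `OpenInputIMC` (19061): the (ram) residual SHRINKS — its {odd non-split witness} ∩ (Locus ∪
# Semistable) part is discharged by the sibling children H3♭ (19270), H2 (19275), the facts (19283),
# Wuthrich 2014 Prop. 21 and Cas18 Thm. 2.3 (file 3 of seat imc-p1's session g2)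

Cell `bsd-stepL` (run/shared/lean/pub/bsd-stepL/), seat `bsd-stepL-imc-p1` (prover; D-0074 row A),
session g2; `--supports stmt-BirchSwinnertonDyer-19274`. HONEST FRAMING: nothing here proves the child or
the crux; BSD is not proved by any of this; the sibling children `IMCDivAtErratumDataAll` (H3♭ at
every pair, ⇐ [FW21, Thm. 4.41], PREPRINT) and `BDPValueCoreFramesAll` (H2 at every pair, cell memo
THEOREM C♯) are OPEN route items taken as HYPOTHESES, and every published ∕ cited named fact is a
hypothesis. THEOREMS ONLY; pure composition of files 1–2 (`ErratumRoadFiveOpenInputIMCOneSided`,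
p422211; `ErratumRoadFiveOpenInputIMCNoSecondPrime`).

## What this file proves

The planner's gen-1 split of 19061 (route rev 3) made the (ram) residual of g0's reduction a child:
`OpenInputRamOffErratumLocus := ∀ W p, Ram W p → ¬ (R1Population W p ∧ ¬ p ∣ ∏c) → P2OpenInputOnTreeAt W p`
(cw 953 630 of the 2 267 348 X11b-shape pairs at `p ≥ 5`, `N < 5·10⁵`). Files 1–2 showed that the
SECOND ramified multiplicative prime of `R1Population` is not needed (the crux is one-sided; the
twist needs only Wuthrich's Euler-system half). Hence:

* §1 `openInputOnTreeAt_of_oddNonsplitRam_of_semistable_of_coreFrames` — pair level, SEMISTABLE, on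
  or off the Locus, from H2 ∧ H3♭ (the sibling children pointwise) + `h23` + named facts (file 2's
  `…_semistable_of_coreFrame` with `h32` replaced by H2, so that the sibling child 19275 is consumed
  as filed).
* §2 **`openInputRamOffErratumLocus_of_children_of_rest`** — `IMCDivAtErratumDataAll` (19270) →
  `BDPValueCoreFramesAll` (19275) → `PublishedInputsIMCReduction` (19283) → `sha_dvd_analyticSha`
  (Wuthrich 2014 Prop. 21, PUB; = support item 19285 `WuthrichShaDividesAnalyticSha` by `rfl`) →
  `thm23_anticyclotomicControl` (Cas18 Thm. 2.3, PUB; not an item of this route) → REST″ →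
  `OpenInputRamOffErratumLocus`, where **REST″** := the open input on the (ram) pairs with NO odd
  non-split `E[p]`-ramified multiplicative `q ≠ p` on (Locus ∪ (Semistable ∧ (iv))) — explicitly
  `∀ W p, Ram W p → ¬ ((∃ q prime, q ≠ 2 ∧ q ≠ p ∧ Mult W q ∧ ¬Split W q ∧ p ∤ v_q(Δ_min)) ∧
  (p ∤ ∏c ∨ (Semistable W ∧ ∀ P ∈ E(ℚ_p), p•P = 0 → P = 0))) → P2OpenInputOnTreeAt W p`.
  Also `openInputRamOffErratumLocus_of_oddNonsplitRam_of_rest` (the glue from children L, L′ of file 2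
  and REST″) and `rest_of_openInputRamOffErratumLocus` (REST″ is implied back by the child together
  with g0's child R, so the proposed re-split loses nothing).

CENSUS (DATA, zero-compute fold of multr1-p1 `census2_all_500k.tsv.gz`; X11b shape, `p ≥ 5`,
`N < 5·10⁵`, class-wide pairs): of child 19274's (ram) rows, 211 869 are discharged here modulo the
siblings (Locus ∩ {odd non-split witness} ∖ R1Population 210 908 + semistable off-Locus 961); REST″ ∩
(ram) = 722 875 = every ramified multiplicative witness SPLIT 531 672 + only `q = 2` non-split 149 052
+ off-Locus non-semistable 34 474 + off-Locus semistable failing (iv) or without odd `q` 7 677.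
CONDITIONAL; nothing booked; closes rung K2 of BirchSwinnertonDyer for NO pair by itself.

References: [Castella2018Erratum] Thm. 1.1, (2.4), Thm. A′ (pp. 1, 4); [Castella2018] Thms. 2.3, 3.1,
3.2, §5 (arXiv:1704.06608); [Wuthrich2014] Prop. 21 (p. 400); [JetchevSkinnerWan2017] Thm. 3.3.1,
§7.4.1; [Skinner2016PacificMC] Thm. C; [Miller2011LMS] Def. 1.1.
-/

set_option autoImplicit false
set_option linter.dupNamespace false

noncomputable section

open scoped Classical

open WeierstrassCurve NumberField IsDedekindDomain Field
open Literature.NumberTheory.EllipticCurves Literature.NumberTheory.EllipticCurves.GreenbergSelmer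
open Literature.NumberTheory.EllipticCurves.ModularForms
open Literature.NumberTheory.EllipticCurves.Rank1Residual
open Literature.NumberTheory.EllipticCurves.Rank1Residual.Typed
open Literature.NumberTheory.EllipticCurves.Wuthrich2014
open Literature.NumberTheory.EllipticCurves.Castella2018
open Literature.NumberTheory.GaloisRepresentations
open Literature.NumberTheory.GaloisCohomology
open Summit.BirchSwinnertonDyer.Rank1Residual Summit.BirchSwinnertonDyer.Rank1Residual.X11b
open Summit.BirchSwinnertonDyer.BirchSwinnertonDyer.Theses

namespace Summit.BirchSwinnertonDyer.BirchSwinnertonDyer.Theorems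

/-! ### §1 Pair level: the semistable part from H2 ∧ H3♭ (the siblings pointwise) -/

section Pair

variable (W : WeierstrassCurve ℚ) [W.IsElliptic] [W.IsGloballyMinimal] (p : ℕ) [Fact p.Prime]

/-- **On SEMISTABLE pairs with an odd non-split (ram) witness and (iv), on or off the Locus, from H2 ∧
H3♭ — no second prime.** File 2's `openInputOnTreeAt_of_oddNonsplitRam_of_semistable_of_coreFrame`
with the value fact `h32` replaced by H2 = `R1.BDPValueCoreFrameOnTree W p` (so that the sibling
child `BDPValueCoreFramesAll` is consumed as filed): H2 ∧ H3♭ + `hGZ86 hGZK hWu hSk hnf hCST hFH hMaz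
hGZ hKo` + `h23` (Cas18 Thm. 2.3: the control identity without `p ∤ ∏c`,
`p2ControlOnTreeAt_of_thm23_of_semistable`) + the cited `hPTs hEP` ⟹ `P2OpenInputOnTreeAt W p`. Lower
half by file 1's `missingLowerBoundAt_of_erratumHypotheses_of_coreFrames`, open input by file 1's
one-sided tightness. CONDITIONAL on H2, H3♭; nothing booked. [cite: Castella2018Erratum, (2.4) (p. 4)]
[cite: Castella2018, Thm. 2.3 (p. 5), §5 (p. 12) (arXiv:1704.06608)] [cite: Wuthrich2014, Prop. 21 (p. 400)]
[cite: Miller2011LMS, Def. 1.1] -/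
theorem openInputOnTreeAt_of_oddNonsplitRam_of_semistable_of_coreFrames
    (hGZ86 : GrossZagier1986_thm_I_7_3) (hGZK : rank_eq_analyticRank_of_analyticRank_le_one)
    (hWu : sha_dvd_analyticSha) (hSk : Skinner2016.thmC_padicValRat_bsd_rank_zero)
    (hnf : exists_isNewformOf) (hCST : CaiShuTian2014.thm11_trivialChar)
    (hFH : friedbergHoffstein_exists_twist_ne_zero_ramifiedAt)
    (hMaz : mazur_not_dvd_maninConstant_of_odd) (h23 : thm23_anticyclotomicControl)
    (hGZ : ∀ (N : ℕ) [NeZero N] (W : WeierstrassCurve ℚ) (K : Type) [Field K] [NumberField K],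
      gross_zagier N W K)
    (hKo : ∀ (N : ℕ) [NeZero N] (W : WeierstrassCurve ℚ) (K : Type) [Field K] [NumberField K],
      kolyvagin N W K)
    (hPTs : ∀ (K : Type) [Field K] [NumberField K], poitouTate_sum_localTatePairing_eq_zero K)
    (hEP : ∀ (K : Type) [Field K] [NumberField K] (v : HeightOneSpectrum (𝓞 K)),
      localEulerPoincareCharacteristic (v.adicCompletion K))
    (hss : Semistable W) (h2 : R1.BDPValueCoreFrameOnTree W p)
    (h3 : P2.IMCDivIntCoreFrameAtErratumData W p)
    {q : ℕ} [Fact q.Prime] (hq2 : q ≠ 2) (hqp : q ≠ p) (hmq : Mult W q)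
    (hnsq : ¬ W.HasSplitMultiplicativeReductionAtPrime q)
    (hvq : ¬ p ∣ padicValInt q W.minimalDiscriminantInt)
    (htors : ∀ P : (W.baseChange ℚ_[p]).toAffine.Point, p • P = 0 → P = 0) :
    P2OpenInputOnTreeAt W p := by
  refine p2OpenInputOnTreeAt_of_imp_surj W p fun hX hp5 _hs ↦ ?_
  have hr : W.analyticRank = 1 := hX.1
  have hram : Ram W p := ⟨q, ‹_›, hqp, hmq, hvq⟩
  have hE : ErratumHypotheses W p := ⟨hp5, hX.2.2.1, hX.2.2.2, ⟨q, ‹_›, hqp, hmq, hnsq, hvq⟩, htors⟩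
  have hlow : Typed.MissingLowerBoundAt W p :=
    missingLowerBoundAt_of_erratumHypotheses_of_coreFrames W p hGZ86 hGZK hWu hnf hCST hFH hMaz hPTs
      hEP h2 h3 hE hq2 hqp hmq hnsq hvq hr
  exact openInputOnTreeAt_of_missingLowerBoundAt_of_ram W p hGZ hKo hSk hGZK
    (hasEntireLFunction_rat_of_exists_isNewformOf hnf)
    (p2ControlOnTreeAt_of_thm23_of_semistable W p h23 hKo hss) hram hlow

end Pair

/-! ### §2 The child `OpenInputRamOffErratumLocus` (19274) from its siblings and the new residual REST″ -/

section Child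

/-- **Glue: the (ram) residual child from children L, L′ (file 2) and REST″.** If the open input holds
on {odd non-split (ram) witness} ∩ {`p ∤ ∏c`} (child L), on the SEMISTABLE pairs with an odd non-split
(ram) witness and (iv) (child L′), and on the (ram) pairs in neither locus (REST″), then it holds on
all of child 19274's rows (indeed on every (ram) pair). Bookkeeping only. [folklore] -/
theorem openInputRamOffErratumLocus_of_oddNonsplitRam_of_rest
    (hL : ∀ (W : WeierstrassCurve ℚ) [W.IsElliptic] [W.IsGloballyMinimal] (p : ℕ) [Fact p.Prime],
      (∃ (q : ℕ) (_ : Fact q.Prime), q ≠ 2 ∧ q ≠ p ∧ Mult W q ∧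
        ¬ W.HasSplitMultiplicativeReductionAtPrime q ∧ ¬ p ∣ padicValInt q W.minimalDiscriminantInt) →
      ¬ p ∣ W.tamagawaProduct → P2OpenInputOnTreeAt W p)
    (hL' : ∀ (W : WeierstrassCurve ℚ) [W.IsElliptic] [W.IsGloballyMinimal] (p : ℕ) [Fact p.Prime],
      Semistable W →
      (∃ (q : ℕ) (_ : Fact q.Prime), q ≠ 2 ∧ q ≠ p ∧ Mult W q ∧
        ¬ W.HasSplitMultiplicativeReductionAtPrime q ∧ ¬ p ∣ padicValInt q W.minimalDiscriminantInt) →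
      (∀ P : (W.baseChange ℚ_[p]).toAffine.Point, p • P = 0 → P = 0) → P2OpenInputOnTreeAt W p)
    (hrest : ∀ (W : WeierstrassCurve ℚ) [W.IsElliptic] [W.IsGloballyMinimal] (p : ℕ) [Fact p.Prime],
      Ram W p →
      ¬ ((∃ (q : ℕ) (_ : Fact q.Prime), q ≠ 2 ∧ q ≠ p ∧ Mult W q ∧
            ¬ W.HasSplitMultiplicativeReductionAtPrime q ∧
            ¬ p ∣ padicValInt q W.minimalDiscriminantInt) ∧
          (¬ p ∣ W.tamagawaProduct ∨
            (Semistable W ∧ ∀ P : (W.baseChange ℚ_[p]).toAffine.Point, p • P = 0 → P = 0))) →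
      P2OpenInputOnTreeAt W p) :
    ErratumRoadFive.OpenInputRamOffErratumLocus := by
  unfold ErratumRoadFive.OpenInputRamOffErratumLocus
  intro W _ _ p _ hram _
  by_cases h : (∃ (q : ℕ) (_ : Fact q.Prime), q ≠ 2 ∧ q ≠ p ∧ Mult W q ∧
      ¬ W.HasSplitMultiplicativeReductionAtPrime q ∧ ¬ p ∣ padicValInt q W.minimalDiscriminantInt) ∧
    (¬ p ∣ W.tamagawaProduct ∨
      (Semistable W ∧ ∀ P : (W.baseChange ℚ_[p]).toAffine.Point, p • P = 0 → P = 0))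
  · obtain ⟨hq, htam | ⟨hss, htors⟩⟩ := h
    · exact hL W p hq htam
    · exact hL' W p hss hq htors
  · exact hrest W p hram h

/-- **Nothing lost: REST″ follows from child 19274 together with g0's child R** (`R1Population ∩
Locus`, itself ⇐ H2 ∧ H3♭ + facts, p417457) — so re-splitting 19274 into {L∖R, L′} (dischargeable)
and REST″ is faithful. Bookkeeping only. [folklore] -/
theorem rest_of_openInputRamOffErratumLocus (hRam : ErratumRoadFive.OpenInputRamOffErratumLocus)
    (hR : ∀ (W : WeierstrassCurve ℚ) [W.IsElliptic] [W.IsGloballyMinimal] (p : ℕ) [Fact p.Prime],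
      R1Population W p → ¬ p ∣ W.tamagawaProduct → P2OpenInputOnTreeAt W p) :
    ∀ (W : WeierstrassCurve ℚ) [W.IsElliptic] [W.IsGloballyMinimal] (p : ℕ) [Fact p.Prime],
      Ram W p →
      ¬ ((∃ (q : ℕ) (_ : Fact q.Prime), q ≠ 2 ∧ q ≠ p ∧ Mult W q ∧
            ¬ W.HasSplitMultiplicativeReductionAtPrime q ∧
            ¬ p ∣ padicValInt q W.minimalDiscriminantInt) ∧
          (¬ p ∣ W.tamagawaProduct ∨
            (Semistable W ∧ ∀ P : (W.baseChange ℚ_[p]).toAffine.Point, p • P = 0 → P = 0))) →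
      P2OpenInputOnTreeAt W p := by
  intro W _ _ p _ hram _
  unfold ErratumRoadFive.OpenInputRamOffErratumLocus at hRam
  by_cases h : R1Population W p ∧ ¬ p ∣ W.tamagawaProduct
  · exact hR W p h.1 h.2
  · exact hRam W p hram h

/-- **CHILD 19274 FROM ITS SIBLINGS AND THE NEW RESIDUAL (the reduction of record of this session).**
`IMCDivAtErratumDataAll` (item 19270: H3♭ at every pair) → `BDPValueCoreFramesAll` (item 19275: H2 at
every pair) → `PublishedInputsIMCReduction` (item 19283: the eleven published + five cited facts) →
`sha_dvd_analyticSha` (Wuthrich 2014 Prop. 21, PUBLISHED; = the route's support item 19285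
`WuthrichShaDividesAnalyticSha` by `rfl` — the Euler-system half of the rank-`0` twist, replacing
Skinner Thm. C (ii)'s second prime) → `thm23_anticyclotomicControl` (Cas18 Thm. 2.3,
PUBLISHED — the control identity at `p ∣ ∏c` on semistable `E`) → REST″ → `OpenInputRamOffErratumLocus`.
REST″ = the open input on the (ram) pairs with NO odd non-split `E[p]`-ramified multiplicative `q ≠ p`
inside (Locus ∪ (Semistable ∧ (iv))): every ramified multiplicative witness split (531 672 cw pairs),
only `q = 2` non-split (149 052), off-Locus non-semistable (34 474), off-Locus semistable failing (iv)
or without odd `q` (7 677) — 722 875 of the child's 953 630 (census fold, `N < 5·10⁵`). The other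
211 869 + the semistable `p ∣ ∏c` rows of `R1Population` are discharged here modulo the siblings.
CONDITIONAL on the sibling items and the named facts; nothing booked; no pair closed by this.
[cite: Castella2018Erratum, Thm. 1.1, (2.4), Thm. A′ (pp. 1, 4)] [cite: Wuthrich2014, Prop. 21 (p. 400)]
[cite: Castella2018, Thm. 2.3 (p. 5), Thms. 3.1–3.2 (p. 9), §5 (p. 12) (arXiv:1704.06608)]
[cite: Skinner2016PacificMC, Thm. C (§1)] [cite: Miller2011LMS, Def. 1.1] -/
theorem openInputRamOffErratumLocus_of_children_of_rest
    (h3 : ErratumRoadFive.IMCDivAtErratumDataAll) (h2 : ErratumRoadFive.BDPValueCoreFramesAll)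
    (hF : ErratumRoadFive.PublishedInputsIMCReduction)
    (hWu : sha_dvd_analyticSha) (h23 : thm23_anticyclotomicControl)
    (hrest : ∀ (W : WeierstrassCurve ℚ) [W.IsElliptic] [W.IsGloballyMinimal] (p : ℕ) [Fact p.Prime],
      Ram W p →
      ¬ ((∃ (q : ℕ) (_ : Fact q.Prime), q ≠ 2 ∧ q ≠ p ∧ Mult W q ∧
            ¬ W.HasSplitMultiplicativeReductionAtPrime q ∧
            ¬ p ∣ padicValInt q W.minimalDiscriminantInt) ∧
          (¬ p ∣ W.tamagawaProduct ∨
            (Semistable W ∧ ∀ P : (W.baseChange ℚ_[p]).toAffine.Point, p • P = 0 → P = 0))) →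
      P2OpenInputOnTreeAt W p) :
    ErratumRoadFive.OpenInputRamOffErratumLocus := by
  unfold ErratumRoadFive.IMCDivAtErratumDataAll at h3
  unfold ErratumRoadFive.BDPValueCoreFramesAll at h2
  obtain ⟨hGZ86, hGZK, hSk, hnf, hCST, hFH, hMaz, hGZ, hKo, -, -, hPTs, hPT, hPT2, hEP, hcd⟩ := hF
  refine openInputRamOffErratumLocus_of_oddNonsplitRam_of_rest
    (openInputIMC_oddNonsplitRamLocus_of_coreFrames hGZ86 hGZK hWu hSk hnf hCST hFH hMaz hGZ hKo hPTs
      hPT hPT2 hEP hcd h2 h3) (fun W _ _ p _ hss hq htors ↦ ?_) hrest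
  obtain ⟨q, _, hq2, hqp, hmq, hnsq, hvq⟩ := hq
  exact openInputOnTreeAt_of_oddNonsplitRam_of_semistable_of_coreFrames W p hGZ86 hGZK hWu hSk hnf hCST
    hFH hMaz h23 hGZ hKo hPTs hEP hss (h2 W p) (h3 W p) hq2 hqp hmq hnsq hvq htors

/-- **The same with H3♭ supplied BY CITATION** from the typed erratum FACT (Castella erratum Thm. 1.1 =
arXiv:2409.01360 Thm. 3.1, OPEN, p417695; g0's bridge `imcDivIntCoreFrameAtErratumData_of_erratumThm11_OPEN`):
modulo the OPEN fact, the sibling `BDPValueCoreFramesAll` (H2), the facts items 19283 ∕ 19285 and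
Cas18 Thm. 2.3, child 19274 SHRINKS to REST″. CONDITIONAL; nothing booked; no pair closed by this.
[claim: Castella2018Erratum, status: under-review] [cite: Wuthrich2014, Prop. 21 (p. 400)]
[cite: Castella2018, Thm. 2.3 (p. 5), §5 (p. 12) (arXiv:1704.06608)] [cite: Miller2011LMS, Def. 1.1] -/
theorem openInputRamOffErratumLocus_of_erratumThm11_OPEN_of_bdpValueCoreFrames_of_rest
    (h11 : erratumThm11_exists_isBDPLFunction_isTorsion_charIdeal_eq_OPEN)
    (h2 : ErratumRoadFive.BDPValueCoreFramesAll) (hF : ErratumRoadFive.PublishedInputsIMCReduction)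
    (hWu : sha_dvd_analyticSha) (h23 : thm23_anticyclotomicControl)
    (hrest : ∀ (W : WeierstrassCurve ℚ) [W.IsElliptic] [W.IsGloballyMinimal] (p : ℕ) [Fact p.Prime],
      Ram W p →
      ¬ ((∃ (q : ℕ) (_ : Fact q.Prime), q ≠ 2 ∧ q ≠ p ∧ Mult W q ∧
            ¬ W.HasSplitMultiplicativeReductionAtPrime q ∧
            ¬ p ∣ padicValInt q W.minimalDiscriminantInt) ∧
          (¬ p ∣ W.tamagawaProduct ∨
            (Semistable W ∧ ∀ P : (W.baseChange ℚ_[p]).toAffine.Point, p • P = 0 → P = 0))) →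
      P2OpenInputOnTreeAt W p) :
    ErratumRoadFive.OpenInputRamOffErratumLocus :=
  openInputRamOffErratumLocus_of_children_of_rest
    (by
      unfold ErratumRoadFive.IMCDivAtErratumDataAll
      exact fun W _ _ p _ ↦ imcDivIntCoreFrameAtErratumData_of_erratumThm11_OPEN (W := W) (p := p) h11)
    h2 hF hWu h23 hrest

end Child

end Summit.BirchSwinnertonDyer.BirchSwinnertonDyer.Theorems

end
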